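import Literature.NumberTheory.QuadraticFields.PrincipalGenusTheorem
import Literature.NumberTheory.EllipticCurves.HeegnerPointsShimuraReciprocity
import Mathlib.NumberTheory.LegendreSymbol.QuadraticReciprocity
import HarnessLib

set_option linter.dupNamespace false -- namespace `…BirchSwinnertonDyer.BirchSwinnertonDyer…` is the cell's (D-0017 nested layout)
set_option autoImplicit false

/-!
# GENUS-SQUARES-EVEN: for `d = −8ℓ`, `ℓ ≡ 7 (mod 8)` prime, the squares of the class group `C(−8ℓ)` form a
# subgroup of EVEN order (the principal genus `C²` contains the ambiguous class `[(2, 0, ℓ)]`; `4 ∣ h(−8ℓ)`)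

Cell `bsd-goldfeld`, seat `bsd-goldfeld-s1p-c3` (prover, gen 17); planner g33 ruling (cli)(E), ORDER
`GENUS-SQUARES-EVEN`. Support for item `stmt-BirchSwinnertonDyer-19350` (twin,
`Summit.BirchSwinnertonDyer.BirchSwinnertonDyer.Theses.GoldfeldAllTwistsTwoConverse.BSDTwoCMSplitRankOne`) through
the F3 lane of seat c3x (THEOREM A″, `…TwinHalfTraceSevenModEightAssembly.lean`, family `49a1^{(−2ℓ)}`,
`ℓ ≡ 7 (mod 8)`, `d_K = −8ℓ`): this file SUPPLIES BY NAME the one class-group input of its hypothesis (H2)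
`Ψ⁻ + τΨ⁻ = O` — Gross 1991 Prop. 5.3 summed over a coset of `ker χ = ker Φ = C²` has `#C²` terms `φ(0) = T`,
and "`#C(𝒪_{−8ℓ})²` is EVEN" (equivalently `4 ∣ h(−8ℓ)`) is what kills them.  It is the exact mirror of seat
c3's GENUS-SQUARES-ODD (`…GoldfeldK12AdditiveTwoGenusSquaresOdd.lean`, `d = −4q`, `q ≡ 5 (mod 8)`, `#C²` ODD).
Theses-free, fact-free: Gauss's genus theory for ONE discriminant on the carrier `ClassGroup (OrderCl.QO Δ)` of
the order `𝒪_D`, `Δ.D = −8ℓ` (the carrier of `heegnerFormClass` / ty's FILE D — NOT `ClassGroup (𝓞 K)`).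

HONEST FRAMING: classical (Gauss, *Disquisitiones* §§257–258, 286; Cox §3.B Thm. 3.15; the `4`-rank statement
is Rédei–Reichardt 1934, here obtained without Rédei matrices); touches no `L`-value; proves no case of twin /
`BSDTwoCMSplitRankOne` (item 19350 unchanged); F3 is a density-zero prime family; BSD is not proved by any of this.

## The argument (road P of the ORDER: the principal genus theorem)

`D = −8ℓ`, `ℓ ≡ 7 (mod 8)` prime; `C = C(𝒪_D) ≅ C(D)` (Cox Thm. 7.7).  The ambiguous reduced form `a = (2, 0, ℓ)`
(discriminant `−8ℓ`; primitive as `ℓ` is odd; reduced as `0 ≤ 2 ≤ ℓ`) has `[a]² = 1` (Cox Lemma 3.10, `b = 0`;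
tree `classOf'_sq_eq_one_iff`) and `[a] ≠ 1` (the principal class is the class of the reduced form `(1, 0, 2ℓ)`,
and two distinct reduced forms are not properly equivalent, Thm. 2.8).  The form `a` represents
`a(1, 1) = ℓ + 2`, a unit modulo `8ℓ`, and `ℓ + 2` IS a value of the principal form `x² + 2ℓy²` modulo `8ℓ`:
since `ℓ ≡ 7 (mod 8)`, `2` is a square modulo `ℓ` (the second supplement, Mathlib `ZMod.exists_sq_eq_two_iff`),
so there is an ODD `x₀` with `x₀² ≡ 2 (mod ℓ)`, and then `x₀² ≡ 1 ≡ ℓ + 2 (mod 8)`, `x₀² ≡ 2 ≡ ℓ + 2 (mod ℓ)`,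
i.e. `x₀² ≡ ℓ + 2 (mod 8ℓ)`.  Hence the genus of `a` is the principal genus: `Φ([a]) = [ℓ+2]·H = H`, `[a] ∈ ker Φ`
(Cox Lemma 2.24 (ii), (3.12); tree `genusHom_classOf'_eq_mk`, `mem_principalValues_iff`).  By THE PRINCIPAL GENUS
THEOREM `ker Φ = C²` (Cox Thm. 3.15 (ii); tree `ker_genusHom_eq_range_pow_two`) the class `[a]` is a square:
**`C²` contains an element of order `2`, so `#C²` is EVEN** (T1′; Lagrange).  With `μ(−8ℓ) = 2` assigned
characters (Cox Prop. 3.11: `D = −4n`, `n = 2ℓ ≡ 2 (mod 4)`, `μ = ω(n) = 2`), `[C : C²] = 2^{μ−1} = 2`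
(`index_range_sq_classGroup_QO`), so `h(−8ℓ) = 2·#C² ≡ 0 (mod 4)` (T2′).  §3 restates T1′ over the field-indexed
carrier `ClassGroup (OrderCl.QO hK.negDiscr)`, `hK : IsImaginaryQuadratic K`, `d_K = −8ℓ`
(`IsImaginaryQuadratic.negDiscr_D`) — the consumer's shape (T3′).  [For `ℓ ≡ 3 (mod 8)` the same form `a` is NOT
in the principal genus (`2` is a non-residue mod `ℓ`) and `#C²` is odd — consistent with "(H2) has an even
number of terms iff `ℓ ≡ 7 (mod 8)`"; not formalised here.]

References: [Cox2013] D. A. Cox, *Primes of the form x² + ny²*, 2nd ed. (2013), §2.A (2.4), Thm. 2.8; §2.C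
Lemma 2.24; §3.A Lemma 3.10, Prop. 3.11; §3.B (3.12), Lemma 3.13, Thm. 3.15; §7.B Thm. 7.7.  [GrossLMS1991]
B. H. Gross, *Kolyvagin's work on modular elliptic curves*, Prop. 5.3 (the consumer).  Sanity: `h(−56) = 4`,
`h(−184) = 4`, `h(−248) = 8`, `h(−376) = 8` (`ℓ = 7, 23, 31, 47`).
-/

noncomputable section

namespace Summit.BirchSwinnertonDyer.BirchSwinnertonDyer.Theorems.GoldfeldGoodTwists

open Literature.Computability.Cryptography.Hallgren2005
open Literature.Computability.Cryptography.Hallgren2005.OrderCl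
open Literature.Computability.Cryptography.Hallgren2005.FormComposition (one one_a isPosPrim_one)
open Literature.NumberTheory.QuadraticFields.Quadratic
open Literature.NumberTheory.QuadraticFields.BinaryQuadraticForm (assignedCharCount classNumber
  assignedCharCount_neg_four_mul_of_mod_four_eq_two)
open Literature.NumberTheory.ComplexMultiplication.CMTypeLattice (finite_classGroup_QO_of_emod_four
  natCard_classGroup_QO_of_emod_four)
open Literature.NumberTheory.EllipticCurves (IsImaginaryQuadratic)

/-! ## §0 Arithmetic of `ℓ ≡ 7 (mod 8)`: `ℓ + 2` is a unit modulo `8ℓ` and a square modulo `8ℓ` -/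

section Arith

variable {l : ℕ}

/-- For `ℓ ≡ 7 (mod 8)` prime, `ℓ + 2` is prime to `8ℓ` (odd, and `ℓ ∤ ℓ + 2` as `ℓ > 2`). [folklore] -/
theorem coprime_add_two_eight_mul (hl : l.Prime) (hl8 : l % 8 = 7) : Nat.Coprime (l + 2) (8 * l) := by
  refine Nat.Coprime.mul_right ?_ ?_
  · have h2 : Nat.Coprime (l + 2) 2 := Nat.coprime_two_right.mpr (Nat.odd_iff.mpr (by omega))
    simpa using h2.pow_right 3
  · refine Nat.Coprime.symm ((Nat.Prime.coprime_iff_not_dvd hl).mpr fun h ↦ ?_)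
    have h2 : l ∣ 2 := by simpa using Nat.dvd_sub h (dvd_refl l)
    have := Nat.le_of_dvd (by norm_num) h2
    omega

/-- `8` is prime to an odd prime `ℓ` (as integers). [folklore] -/
theorem isCoprime_eight_of_mod_eight (hl8 : l % 8 = 7) : IsCoprime (8 : ℤ) (l : ℤ) := by
  have h : Nat.Coprime 8 l := by
    have h2 : Nat.Coprime 2 l := Nat.coprime_two_left.mpr (Nat.odd_iff.mpr (by omega))
    simpa using h2.pow_left 3
  exact_mod_cast Nat.isCoprime_iff_coprime.mpr h

/-- **`ℓ + 2` is a square modulo `8ℓ` for a prime `ℓ ≡ 7 (mod 8)`**: by the second supplement to quadratic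
reciprocity (`2` is a square mod `ℓ` iff `ℓ ≡ ±1 (mod 8)`, Mathlib `ZMod.exists_sq_eq_two_iff`) there is `x₁` with
`x₁² ≡ 2 (mod ℓ)`; the ODD representative `x₀ = x₁ + ℓ(x₁ + 1) ≡ 7 (mod 8)` has `x₀² ≡ 1 ≡ ℓ + 2 (mod 8)` and
`x₀² ≡ 2 ≡ ℓ + 2 (mod ℓ)`. [cite: Cox2013, §1.A (quadratic reciprocity, second supplement) with §2.C Lemma 2.24] -/
theorem exists_eight_mul_dvd_sq_sub_add_two (hl : l.Prime) (hl8 : l % 8 = 7) :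
    ∃ x : ℤ, 8 * (l : ℤ) ∣ x ^ 2 - ((l : ℤ) + 2) := by
  haveI := Fact.mk hl
  have hl2 : l ≠ 2 := by omega
  obtain ⟨r, hr⟩ := (ZMod.exists_sq_eq_two_iff hl2).mpr (Or.inr hl8)
  -- `n = x₁`, a lift of `r`: `ℓ ∣ n² - 2`
  obtain ⟨n, hn⟩ : ∃ n : ℤ, (n : ZMod l) = r := ⟨(r.val : ℤ), by rw [Int.cast_natCast, ZMod.natCast_zmod_val]⟩
  have hdvd : (l : ℤ) ∣ n ^ 2 - 2 := by
    refine (ZMod.intCast_zmod_eq_zero_iff_dvd _ l).mp ?_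
    push_cast
    rw [hn, sq, ← hr, sub_self]
  obtain ⟨c, hc⟩ := hdvd
  refine ⟨n + l * (n + 1), IsCoprime.mul_dvd (isCoprime_eight_of_mod_eight hl8) ?_ ?_⟩
  · -- modulo `8`: `x₀ ≡ n + 7(n + 1) ≡ 7`, `x₀² - (ℓ + 2) ≡ 49 - 9 ≡ 0`
    refine (ZMod.intCast_zmod_eq_zero_iff_dvd _ 8).mp ?_
    have hl' : ((l : ℕ) : ZMod 8) = 7 := by rw [← ZMod.natCast_mod, hl8]; rfl
    have key : ∀ N : ZMod 8, (N + 7 * (N + 1)) ^ 2 - (7 + 2) = 0 := by decide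
    push_cast
    rw [hl']
    exact key _
  · -- modulo `ℓ`: `x₀² - (ℓ + 2) = (n² - 2) + ℓ·(2n(n+1) + ℓ(n+1)² - 1)`
    exact ⟨c + 2 * n * (n + 1) + (l : ℤ) * (n + 1) ^ 2 - 1, by linear_combination hc⟩

end Arith

/-! ## §1 The ambiguous form `a = (2, 0, ℓ)` of discriminant `−8ℓ`: `[a]² = 1`, `[a] ≠ 1`, `[a] ∈ ker Φ = C²` -/

section Form

variable (Δ : NegDiscr) {l : ℕ}

/-- `−8ℓ ≡ 0 (mod 4)`. [folklore] -/
theorem D_emod_four_of_eq_neg_eight_mul (hΔ : Δ.D = -(8 * (l : ℤ))) : Δ.D % 4 = 0 := by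
  rw [hΔ]; omega

/-- **`a = (2, 0, ℓ)` is a primitive positive definite form of discriminant `−8ℓ`** (`ℓ` odd:
`0 − 4·2·ℓ = −8ℓ`, `gcd(2, 0, ℓ) = 1`). [cite: Cox2013, §2.A (primitive positive definite forms)] -/
theorem isPosPrim_twoZeroForm (hl8 : l % 8 = 7) (hΔ : Δ.D = -(8 * (l : ℤ))) :
    (⟨2, 0, (l : ℤ)⟩ : BinQF).IsPosPrim Δ.D := by
  refine ⟨?_, by norm_num, ?_⟩
  · simp only [BinQF.disc, hΔ]
    ring
  · show Nat.gcd (Nat.gcd (2 : ℤ).natAbs (0 : ℤ).natAbs) (l : ℤ).natAbs = 1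
    rw [Int.natAbs_natCast]
    exact Nat.coprime_two_left.mpr (Nat.odd_iff.mpr (by omega))

/-- **`a = (2, 0, ℓ)` is reduced** (`|b| = 0 ≤ a = 2 ≤ c = ℓ`, and `b ≥ 0`). [cite: Cox2013, §2.A (2.4) (reduced forms)] -/
theorem isReduced_twoZeroForm (hl8 : l % 8 = 7) : (⟨2, 0, (l : ℤ)⟩ : BinQF).IsReduced := by
  refine ⟨by norm_num, ?_, fun _ ↦ le_rfl⟩
  show (2 : ℤ) ≤ (l : ℤ)
  omega

/-- **`[a]² = 1` in `C(𝒪_{−8ℓ})`**: the reduced form `a = (2, 0, ℓ)` is ambiguous (`b = 0`), Cox Lemma 3.10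
(tree `classOf'_sq_eq_one_iff`). [cite: Cox2013, §3.A Lemma 3.10] -/
theorem classOf'_twoZeroForm_sq (hl8 : l % 8 = 7) (hΔ : Δ.D = -(8 * (l : ℤ))) :
    classOf' Δ ⟨2, 0, (l : ℤ)⟩ ^ 2 = 1 :=
  (classOf'_sq_eq_one_iff Δ (isPosPrim_twoZeroForm Δ hl8 hΔ) (isReduced_twoZeroForm hl8)).mpr (Or.inl rfl)

/-- **`[a] ≠ 1` in `C(𝒪_{−8ℓ})`**: the principal class is the class of the principal form `(1, 0, 2ℓ)`
(`classOf'_one`), which is reduced, and two distinct REDUCED forms are never properly equivalent (Cox Thm. 2.8,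
uniqueness; tree `eq_of_properEquiv_of_isReduced`) — `(2, 0, ℓ) ≠ (1, 0, 2ℓ)`. [cite: Cox2013, §2.A Thm. 2.8 with §7.B Thm. 7.7 (ii)] -/
theorem classOf'_twoZeroForm_ne_one (hl8 : l % 8 = 7) (hΔ : Δ.D = -(8 * (l : ℤ))) :
    classOf' Δ ⟨2, 0, (l : ℤ)⟩ ≠ 1 := by
  intro h
  have hD4 : Δ.D % 4 = 0 ∨ Δ.D % 4 = 1 := Or.inl (D_emod_four_of_eq_neg_eight_mul Δ hΔ)
  have hone := isPosPrim_one Δ.neg hD4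
  rw [← classOf'_one Δ hD4,
    classOf'_eq_classOf'_iff_properEquiv Δ (isPosPrim_twoZeroForm Δ hl8 hΔ) hone.1] at h
  have heq := BinQF.eq_of_properEquiv_of_isReduced (isPosPrim_twoZeroForm Δ hl8 hΔ) hone.1
    (isReduced_twoZeroForm hl8) hone.2 h
  have ha := congrArg BinQF.a heq
  rw [one_a] at ha
  norm_num at ha

/-- **`[a]` lies in the principal genus: `[a] ∈ ker Φ`** for Cox's genus homomorphism `Φ = genusHom Δ`
(`D = −8ℓ`, `ℓ ≡ 7 (mod 8)` prime).  The form `a` represents `a(1, 1) = ℓ + 2`, a unit modulo `8ℓ`, so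
`Φ([a]) = [ℓ + 2]·H` (Cox (3.12) / Lemma 2.24 (ii); tree `genusHom_classOf'_eq_mk`); and `ℓ + 2 ∈ H`, i.e. `ℓ + 2`
is represented modulo `8ℓ` by the principal form `x² + 2ℓy²` (`mem_principalValues_iff`): `x₀² ≡ ℓ + 2 (mod 8ℓ)`
(`exists_eight_mul_dvd_sq_sub_add_two`, where `ℓ ≡ 7 (mod 8)` is used). [cite: Cox2013, §2.C Lemma 2.24 and §3.B (3.12)] -/
theorem classOf'_twoZeroForm_mem_ker_genusHom (hl : l.Prime) (hl8 : l % 8 = 7)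
    (hΔ : Δ.D = -(8 * (l : ℤ))) :
    classOf' Δ ⟨2, 0, (l : ℤ)⟩ ∈ (genusHom Δ).ker := by
  have hD0 : Δ.D ≠ 0 := Δ.neg.ne
  haveI : NeZero Δ.D.natAbs := ⟨Int.natAbs_ne_zero.mpr hD0⟩
  have hn : Δ.D.natAbs = 8 * l := by rw [hΔ, Int.natAbs_neg]; rfl
  -- the unit `u = [ℓ + 2] ∈ (ℤ/8ℓℤ)*`
  have hcop : Nat.Coprime (l + 2) Δ.D.natAbs := by rw [hn]; exact coprime_add_two_eight_mul hl hl8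
  set u : (ZMod Δ.D.natAbs)ˣ := ZMod.unitOfCoprime (l + 2) hcop
  have hcoe : (u : ZMod Δ.D.natAbs) = ((l + 2 : ℕ) : ZMod Δ.D.natAbs) := ZMod.coe_unitOfCoprime _ hcop
  -- `u` is a value of `a`: `a(1, 1) = 2 + ℓ`
  have hval : u ∈ BinQF.valueSet ⟨2, 0, (l : ℤ)⟩ Δ.D := by
    refine (BinQF.mem_valueSet_iff).mpr ⟨1, 1, ?_⟩
    rw [hcoe, show BinQF.eval ⟨2, 0, (l : ℤ)⟩ 1 1 = (((l + 2 : ℕ) : ℤ)) by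
      simp only [BinQF.eval]; push_cast; ring, Int.cast_natCast]
  rw [MonoidHom.mem_ker, genusHom_classOf'_eq_mk Δ (isPosPrim_twoZeroForm Δ hl8 hΔ) hval,
    QuotientGroup.eq_one_iff, mem_principalValues_iff hD0]
  -- `ℓ + 2 = x₀² + 2ℓ·0²` modulo `8ℓ`
  obtain ⟨x, hx⟩ := exists_eight_mul_dvd_sq_sub_add_two hl hl8
  refine ⟨x, 0, ?_⟩
  rw [one_eval_zero_right, hcoe, ← sub_eq_zero, ← Int.cast_natCast (R := ZMod Δ.D.natAbs) (l + 2),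
    ← Int.cast_sub, ZMod.intCast_zmod_eq_zero_iff_dvd, Int.natAbs_dvd, hΔ, Int.neg_dvd]
  push_cast
  exact hx

/-- **`[a]` is a square in `C(𝒪_{−8ℓ})`** — THE PRINCIPAL GENUS THEOREM `ker Φ = C²` (Cox Thm. 3.15 (ii); tree
`ker_genusHom_eq_range_pow_two`) applied to `[a] ∈ ker Φ`. [cite: Cox2013, §3.B Thm. 3.15 (ii)] -/
theorem classOf'_twoZeroForm_mem_range_powMonoidHom_two (hl : l.Prime) (hl8 : l % 8 = 7)
    (hΔ : Δ.D = -(8 * (l : ℤ))) :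
    classOf' Δ ⟨2, 0, (l : ℤ)⟩ ∈ (powMonoidHom 2 : ClassGroup (QO Δ) →* ClassGroup (QO Δ)).range := by
  rw [← ker_genusHom_eq_range_pow_two Δ (Or.inl (D_emod_four_of_eq_neg_eight_mul Δ hΔ))]
  exact classOf'_twoZeroForm_mem_ker_genusHom Δ hl hl8 hΔ

/-- `[a]` is a square class (unbundled form of the previous lemma). [cite: Cox2013, §3.B Thm. 3.15 (ii)] -/
theorem isSquare_classOf'_twoZeroForm (hl : l.Prime) (hl8 : l % 8 = 7) (hΔ : Δ.D = -(8 * (l : ℤ))) :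
    IsSquare (classOf' Δ ⟨2, 0, (l : ℤ)⟩) := by
  obtain ⟨r, hr⟩ := classOf'_twoZeroForm_mem_range_powMonoidHom_two Δ hl hl8 hΔ
  exact ⟨r, by rw [← hr, powMonoidHom_apply, sq]⟩

/-- **`[a]` has order exactly `2`** in `C(𝒪_{−8ℓ})` (`[a]² = 1`, `[a] ≠ 1`). [cite: Cox2013, §3.A Lemma 3.10] -/
theorem orderOf_classOf'_twoZeroForm (hl8 : l % 8 = 7) (hΔ : Δ.D = -(8 * (l : ℤ))) :
    orderOf (classOf' Δ ⟨2, 0, (l : ℤ)⟩) = 2 := by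
  haveI : Fact (Nat.Prime 2) := ⟨Nat.prime_two⟩
  exact orderOf_eq_prime (classOf'_twoZeroForm_sq Δ hl8 hΔ) (classOf'_twoZeroForm_ne_one Δ hl8 hΔ)

end Form

/-! ## §2 `C(−8ℓ)`: T1′ `#C²` even; `μ = 2`, `#C² · 2 = h(−8ℓ)`, T2′ `h(−8ℓ) ≡ 0 (mod 4)` -/

section ClassGroup

variable (Δ : NegDiscr) {l : ℕ}

/-- **T1′ — the subgroup `C²` of squares of `C(𝒪_{−8ℓ})` has EVEN order**, `ℓ ≡ 7 (mod 8)` prime: it contains the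
class `[(2, 0, ℓ)]` of order `2` (principal genus theorem), and the order of an element divides the order of the
(finite) group. [cite: Cox2013, §3.B Thm. 3.15 (ii) with §3.A Lemma 3.10] -/
theorem even_natCard_range_powMonoidHom_two_classGroup_QO_neg_eight_mul (Δ : NegDiscr) (l : ℕ) (hl : l.Prime)
    (hl8 : l % 8 = 7) (hΔ : Δ.D = -(8 * (l : ℤ))) :
    Even (Nat.card (powMonoidHom 2 : ClassGroup (QO Δ) →* ClassGroup (QO Δ)).range) := by
  have h := Subgroup.orderOf_dvd_natCard _ (classOf'_twoZeroForm_mem_range_powMonoidHom_two Δ hl hl8 hΔ)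
  rw [orderOf_classOf'_twoZeroForm Δ hl8 hΔ] at h
  exact even_iff_two_dvd.mpr h

/-- **T1′ (set-of-squares form) — the number of SQUARE classes of `C(𝒪_{−8ℓ})` is EVEN**, `ℓ ≡ 7 (mod 8)` prime.
[cite: Cox2013, §3.B Thm. 3.15 (ii) with §3.A Lemma 3.10] -/
theorem even_natCard_isSquare_classGroup_QO_neg_eight_mul (Δ : NegDiscr) (l : ℕ) (hl : l.Prime)
    (hl8 : l % 8 = 7) (hΔ : Δ.D = -(8 * (l : ℤ))) :
    Even (Nat.card {c : ClassGroup (QO Δ) // IsSquare c}) := by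
  have hmem : ∀ c : ClassGroup (QO Δ),
      c ∈ (powMonoidHom 2 : ClassGroup (QO Δ) →* ClassGroup (QO Δ)).range ↔ IsSquare c := fun c ↦ by
    rw [MonoidHom.mem_range, isSquare_iff_exists_sq]
    exact ⟨fun ⟨x, hx⟩ ↦ ⟨x, hx.symm⟩, fun ⟨x, hx⟩ ↦ ⟨x, hx.symm⟩⟩
  rw [Nat.card_congr (Equiv.subtypeEquivRight fun c ↦ (hmem c).symm)]
  exact even_natCard_range_powMonoidHom_two_classGroup_QO_neg_eight_mul Δ l hl hl8 hΔ

/-- **`μ(−8ℓ) = 2`** assigned characters (`D = −4n`, `n = 2ℓ ≡ 2 (mod 4)`: `χ_ℓ` and one even character,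
`μ = ω(2ℓ) = 2`; Cox Prop. 3.11's table). [cite: Cox2013, §3.A Prop. 3.11] -/
theorem assignedCharCount_neg_eight_mul_prime (hl : l.Prime) (hl8 : l % 8 = 7) (hΔ : Δ.D = -(8 * (l : ℤ))) :
    assignedCharCount Δ.D = 2 := by
  have h : Δ.D = -4 * ((2 * l : ℕ) : ℤ) := by rw [hΔ]; push_cast; ring
  rw [h, assignedCharCount_neg_four_mul_of_mod_four_eq_two (n := 2 * l) (by omega),
    Nat.primeFactors_mul (by norm_num) hl.ne_zero, Nat.prime_two.primeFactors, hl.primeFactors, ← Finset.insert_eq,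
    Finset.card_pair (by omega : 2 ≠ l)]

/-- **`#C² · 2 = h(−8ℓ)`**: `[C : C²] = 2^{μ−1} = 2` (Cox, proof of Thm. 3.15; tree `index_range_sq_classGroup_QO`)
and `#C(𝒪_D) = h(D)` (Thm. 7.7 (ii); tree `natCard_classGroup_QO_of_emod_four`). [cite: Cox2013, §3.B proof of Thm. 3.15 and §7.B Thm. 7.7 (ii)] -/
theorem natCard_range_powMonoidHom_two_mul_two_eq_classNumber_neg_eight_mul (Δ : NegDiscr) (l : ℕ)
    (hl : l.Prime) (hl8 : l % 8 = 7) (hΔ : Δ.D = -(8 * (l : ℤ))) :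
    Nat.card (powMonoidHom 2 : ClassGroup (QO Δ) →* ClassGroup (QO Δ)).range * 2 = classNumber Δ.D := by
  have hD4 : Δ.D % 4 = 0 ∨ Δ.D % 4 = 1 := Or.inl (D_emod_four_of_eq_neg_eight_mul Δ hΔ)
  haveI := finite_classGroup_QO_of_emod_four Δ hD4
  have hidx := index_range_sq_classGroup_QO Δ hD4
  rw [assignedCharCount_neg_eight_mul_prime Δ hl hl8 hΔ] at hidx
  norm_num at hidx
  have hcm := Subgroup.card_mul_index (powMonoidHom 2 : ClassGroup (QO Δ) →* ClassGroup (QO Δ)).range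
  rw [hidx] at hcm
  rw [← natCard_classGroup_QO_of_emod_four Δ hD4]
  exact hcm

/-- **`h(−8ℓ) ≡ 0 (mod 4)` for `ℓ ≡ 7 (mod 8)` prime** (`h = 2 · #C²` with `#C²` even), on the bundled carrier.
[cite: Cox2013, §3.B Thm. 3.15 with §3.A Prop. 3.11] -/
theorem classNumber_neg_eight_mul_mod_four (Δ : NegDiscr) (l : ℕ) (hl : l.Prime) (hl8 : l % 8 = 7)
    (hΔ : Δ.D = -(8 * (l : ℤ))) : classNumber Δ.D % 4 = 0 := by
  obtain ⟨k, hk⟩ := even_natCard_range_powMonoidHom_two_classGroup_QO_neg_eight_mul Δ l hl hl8 hΔ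
  rw [← natCard_range_powMonoidHom_two_mul_two_eq_classNumber_neg_eight_mul Δ l hl hl8 hΔ, hk]
  omega

/-- **T2′ — `h(−8ℓ) ≡ 0 (mod 4)` for every prime `ℓ ≡ 7 (mod 8)`** (Gauss: `μ = 2` genera, and the principal
genus `C²` has even order). [cite: Cox2013, §3.B Thm. 3.15 with §3.A Prop. 3.11] -/
theorem classNumber_neg_eight_mul_prime_mod_four (l : ℕ) (hl : l.Prime) (hl8 : l % 8 = 7) :
    classNumber (-(8 * (l : ℤ))) % 4 = 0 :=
  classNumber_neg_eight_mul_mod_four ⟨-(8 * (l : ℤ)), by have := hl.pos; omega⟩ l hl hl8 rfl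

/-- **`4 ∣ h(−8ℓ)` for every prime `ℓ ≡ 7 (mod 8)`** (divisibility form of T2′). [cite: Cox2013, §3.B Thm. 3.15 with §3.A Prop. 3.11] -/
theorem four_dvd_classNumber_neg_eight_mul_prime (l : ℕ) (hl : l.Prime) (hl8 : l % 8 = 7) :
    4 ∣ classNumber (-(8 * (l : ℤ))) :=
  Nat.dvd_of_mod_eq_zero (classNumber_neg_eight_mul_prime_mod_four l hl hl8)

end ClassGroup

/-! ## §3 The consumer's shape: over the carrier `ClassGroup (OrderCl.QO hK.negDiscr)` of an imaginary quadratic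
field `K` with `d_K = −8ℓ` -/

section Field

variable {l : ℕ} (K : Type*) [Field K] [NumberField K] (hK : IsImaginaryQuadratic K)

/-- **T3′ — T1′ over the field-indexed carrier**: `#Cl(𝒪_{d_K})²` is EVEN for `K` imaginary quadratic with
`d_K = −8ℓ`, `ℓ ≡ 7 (mod 8)` prime (the (H2) input of THEOREM A″: the coset of `ker χ = Cl²` carrying `σ_𝔫` has an
even number of terms). [cite: Cox2013, §3.B Thm. 3.15 (ii) with §3.A Lemma 3.10] -/
theorem even_natCard_range_powMonoidHom_two_of_discr_eq_neg_eight_mul (hl : l.Prime) (hl8 : l % 8 = 7)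
    (hdK : NumberField.discr K = -(8 * (l : ℤ))) :
    Even (Nat.card (powMonoidHom 2 : ClassGroup (QO hK.negDiscr) →* ClassGroup (QO hK.negDiscr)).range) :=
  even_natCard_range_powMonoidHom_two_classGroup_QO_neg_eight_mul hK.negDiscr l hl hl8
    (by rw [hK.negDiscr_D, hdK])

/-- **T3′ (set-of-squares form)**: the number of square classes of `Cl(𝒪_{d_K})` is even for `d_K = −8ℓ`,
`ℓ ≡ 7 (mod 8)` prime. [cite: Cox2013, §3.B Thm. 3.15 (ii) with §3.A Lemma 3.10] -/
theorem even_natCard_isSquare_of_discr_eq_neg_eight_mul (hl : l.Prime) (hl8 : l % 8 = 7)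
    (hdK : NumberField.discr K = -(8 * (l : ℤ))) :
    Even (Nat.card {c : ClassGroup (QO hK.negDiscr) // IsSquare c}) :=
  even_natCard_isSquare_classGroup_QO_neg_eight_mul hK.negDiscr l hl hl8 (by rw [hK.negDiscr_D, hdK])

/-- **T2′ over the field**: `h(d_K) ≡ 0 (mod 4)` for `K` imaginary quadratic with `d_K = −8ℓ`, `ℓ ≡ 7 (mod 8)`
prime. [cite: Cox2013, §3.B Thm. 3.15 with §3.A Prop. 3.11] -/
theorem classNumber_discr_mod_four_of_discr_eq_neg_eight_mul (hl : l.Prime) (hl8 : l % 8 = 7)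
    (hdK : NumberField.discr K = -(8 * (l : ℤ))) : classNumber (NumberField.discr K) % 4 = 0 := by
  rw [hdK]
  exact classNumber_neg_eight_mul_prime_mod_four l hl hl8

end Field

end Summit.BirchSwinnertonDyer.BirchSwinnertonDyer.Theorems.GoldfeldGoodTwists

end
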